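import Summits.BirchSwinnertonDyer.Rank1Residual.X11b.PoitouTateSelmerCounting
import Summits.BirchSwinnertonDyer.Rank1Residual.GaloisImage.KolyvaginLevelCounting
import HarnessLib

/-!
# The PRODUCT counting form of Poitou–Tate duality for Selmer structures:
# `[H¹_𝓖(K,M) : H¹_𝓕(K,M)] · [H¹_{𝓕^*}(K,M^D) : H¹_{𝓖^*}(K,M^D)] = ∏_{v ∈ T} [𝓖_v : 𝓕_v]`
# for `𝓕 ≤ 𝓖` differing at a FINITE SET `T` of finite places (cell `b2b-bsdres`, CLASS-CLOSURE
# lane, class O10 — x1b GEN 36, class lead; file 58 of the series: brick B5 of the global count (C)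
# in the form the count needs — several places at once — over the tree's named fact
# `poitouTate_selmerStructure_duality` and X11b's one-place counting form)

HONEST FRAMING (cell `b2b-bsdres`, run/shared/lean/b2b/bsd-rank1-residual/, verbatim in every
file): the goal of the cell is to DELETE the COMBINATION-SHAPED residual classes of the
Birch–Swinnerton-Dyer formula for ALL analytic-rank `≤ 1` elliptic curves over `ℚ` — "full BSD
formula for every rank `≤ 1` curve in class `C`" assembled STRICTLY from published theorems — so
that the rank-`≤ 1` remainder becomes exactly the CONSTRUCTION-SHAPED classes, which are TYPED
(missing-input `Prop`s), NOT attempted. This is not "finishing BSD". CLASS-CLOSURE lane: prove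
what is provable now; shrink each hard class to its core with data; no claim beyond stated classes;
research routes on CONSTRUCTION-SHAPED X12 / O10; census / instrument output = EVIDENCE / conjecture
items, NEVER a Literature fact; `RESIDUAL-MAP.md` marks change only by signed lines. THIS FILE:
TOOL THEOREMS ONLY in the Poitou–Tate vocabulary of the tree
(`DiscreteGaloisModule.SelmerStructure`, `LocalInvariants.dualSelmerStructure`; the Poitou–Tate
input is the property list of the named fact `poitouTate_selmerStructure_duality`, taken as
HYPOTHESES `IsPerfect`, `SumLocalTermEqZero`, `SelmerComplement` on the family `inv`, exactly as in
X11b's `PoitouTateSelmerCounting`) — no definition, no named Literature fact, no Summits-side fact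
`def … : Prop`, no `sorry`, axioms standard; nothing is booked; no label / mark / count / sub-cell
moves; O10 stays OPEN / CONSTRUCTION-SHAPED; nothing about `BSD(W, p)` of any pair is claimed.

## What

X11b (multr1-p1) proved the counting form of Howard 2004 Thm. 2.1.11 for Selmer structures
`𝓕 ≤ 𝓖` on a finite `n`-torsion module `M`, unramified outside `S`, which differ at ONE finite place
`v₀ ∈ S` (`X11b.PoitouTateCounting.relIndex_selmerGroup_mul_relIndex_dual_eq`; the shape of
Jetchev–Skinner–Wan 2017 Prop. 3.2.1). The global count (C) of class O10 (x1b GEN 31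
`C3ETA-TRANSVERSALITY-x1b.md` §4, GEN 36 note §2) compares a level-`0` structure with a level-`∞`
structure that differ at EVERY bad place and at `p`; the same is true of Greenberg's Euler
characteristic computation (LNM 1716 §4) and of the Wiles / Darmon–Diamond–Taylor product formula.
THIS FILE inducts the one-place identity over a finite set `T` of finite places of `S`:

* `relIndex_selmerGroup_mul_relIndex_dual_eq_prod` — for `𝓕 ≤ 𝓖` unramified outside `S`, agreeing
  at every place not of the form `v ∈ T` (`T ⊆ S` finite places):
  **`[H¹_𝓖 : H¹_𝓕] · [H¹_{𝓕^*} : H¹_{𝓖^*}] = ∏_{v ∈ T} [𝓖_v : 𝓕_v]`**.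
  Step: `𝓗 = 𝓖` updated at `v₀` to `𝓕_{v₀}` sits between (`𝓕 ≤ 𝓗 ≤ 𝓖`), differs from `𝓖` at `v₀`
  only and from `𝓕` on `T ∖ {v₀}` only; indices and dual indices multiply along the chain
  (`AddSubgroup.relIndex_mul_relIndex`; `selmerGroup_mono`, `dualSelmerStructure_anti`).
* `relIndex_selmerGroup_dvd_prod` — `[H¹_𝓖 : H¹_𝓕] ∣ ∏_{v ∈ T} [𝓖_v : 𝓕_v]`;
  `relIndex_selmerGroup_eq_prod_iff_dual` — equality iff the dual Selmer groups agree
  (surjectivity of `H¹_𝓖 → ⊕_{v ∈ T} 𝓖_v/𝓕_v`).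

NOT here: the O10 instance (`M = W[p^n]`, `𝓕` = level-`0` strict-minus structure, `𝓖` = level-`∞`
conditions; the bridge to p17's `strictSignedSelmerLayer` and the stabilisation `n → ∞`).

References: [Howard2004HeegnerKolyvagin] B. Howard, Compositio 140 (2004), Thm. 2.1.11;
[MilneADT2006] I Thm. 4.10; [JetchevSkinnerWan2017] Prop. 3.2.1 proof; [GreenbergLNM1716] §4
(pp. 98–103); H. Darmon, F. Diamond, R. Taylor, *Fermat's Last Theorem* (1997), Thm. 2.19 (the
product formula for `#H¹_𝓛 / #H¹_{𝓛^*}`).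
-/

noncomputable section

open scoped Classical

open Function NumberField IsDedekindDomain
open Literature.NumberTheory.GaloisRepresentations
open Literature.NumberTheory.GaloisRepresentations.DiscreteGaloisModule (localTatePairingZMod
  tateDual SelmerStructure)
open Literature.NumberTheory.GaloisCohomology
open Literature.NumberTheory.GaloisCohomology.LocalInvariants
open Summit.BirchSwinnertonDyer.Rank1Residual.GaloisImage.CoreRankZero (selmerGroup_mono)
open Summit.BirchSwinnertonDyer.Rank1Residual.X11b.PoitouTateCounting

universe u

namespace Summit.BirchSwinnertonDyer.Rank1Residual.Additive.PoitouTateCountingProduct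

variable {K : Type u} [Field K] [NumberField K] {n : ℕ} {M : Type u} [AddCommGroup M]
  [TopologicalSpace M] [DiscreteTopology M] [Finite M] {inv : LocalInvariants K n}
  {ρ : DiscreteGaloisModule K M} {S : Finset (Place K)}

/-- **The product counting form of Poitou–Tate duality for Selmer structures.** For a family
`inv` with `IsPerfect`, `SumLocalTermEqZero`, `SelmerComplement` (the property list of the named
fact `poitouTate_selmerStructure_duality`), a finite `Γ_K`-module `M` killed by `n`,
`S ⊇ {v ∣ ∞} ∪ {v ∣ n} ∪ Ram(M)`, a finite set `T` of finite places with `T ⊆ S`, and Selmer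
structures `𝓕 ≤ 𝓖`, `𝓖` unramified outside `S` (hence `𝓕` too), that agree at every place `v ∉ T`:
**`[H¹_𝓖(K,M) : H¹_𝓕(K,M)] · [H¹_{𝓕^*}(K,M^D) : H¹_{𝓖^*}(K,M^D)] = ∏_{v ∈ T} [𝓖_v : 𝓕_v]`.**
Induction on `T` from X11b's one-place identity through the intermediate structure
`𝓖[v₀ ↦ 𝓕_{v₀}]`. [cite: Howard2004HeegnerKolyvagin, Thm. 2.1.11 (arXiv:1202.6340 p. 6)]
[cite: MilneADT2006, I Thm. 4.10] [cite: GreenbergLNM1716, §4 (pp. 98–103)] -/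
theorem relIndex_selmerGroup_mul_relIndex_dual_eq_prod [NeZero n] (hperf : inv.IsPerfect)
    (hvan : inv.SumLocalTermEqZero) (hcomp : inv.SelmerComplement) (hM : ∀ m : M, n • m = 0)
    (hS : ∀ v : HeightOneSpectrum (𝓞 K), (Sum.inr v : Place K) ∉ S →
      ((n : ℕ) : 𝓞 K) ∉ v.asIdeal ∧ GaloisRep.IsUnramifiedAt v ρ)
    (T : Finset (HeightOneSpectrum (𝓞 K))) (hT : ∀ w ∈ T, (Sum.inr w : Place K) ∈ S)
    {𝓕 : SelmerStructure ρ} :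
    ∀ {𝓖 : SelmerStructure ρ}, 𝓕 ≤ 𝓖 → 𝓖.IsUnramifiedOutside S →
      (∀ v : Place K, (∀ w ∈ T, v ≠ Sum.inr w) → 𝓕 v = 𝓖 v) →
      𝓕.selmerGroup.relIndex 𝓖.selmerGroup *
          (inv.dualSelmerStructure ρ 𝓖).selmerGroup.relIndex
            (inv.dualSelmerStructure ρ 𝓕).selmerGroup =
        ∏ w ∈ T, (𝓕 (Sum.inr w)).relIndex (𝓖 (Sum.inr w)) := by
  induction T using Finset.induction_on with
  | empty =>
    intro 𝓖 _ _ hdiff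
    have hFG : 𝓕 = 𝓖 := funext fun v => hdiff v (fun w hw => absurd hw (Finset.notMem_empty w))
    subst hFG
    rw [Finset.prod_empty, AddSubgroup.relIndex_self, AddSubgroup.relIndex_self, mul_one]
  | insert w₀ T' hw₀ ih =>
    intro 𝓖 hle h𝓖 hdiff
    have hT' : ∀ w ∈ T', (Sum.inr w : Place K) ∈ S := fun w hw => hT w (Finset.mem_insert_of_mem hw)
    have hw₀S : (Sum.inr w₀ : Place K) ∈ S := hT w₀ (Finset.mem_insert_self w₀ T')
    set v₀ : Place K := Sum.inr w₀ with hv₀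
    -- the intermediate structure `𝓗 = 𝓖[v₀ ↦ 𝓕 v₀]`
    set 𝓗 : SelmerStructure ρ := Function.update 𝓖 v₀ (𝓕 v₀) with h𝓗
    have h𝓗v₀ : 𝓗 v₀ = 𝓕 v₀ := by rw [h𝓗, Function.update_self]
    have h𝓗ne : ∀ v ≠ v₀, 𝓗 v = 𝓖 v := fun v hv => by rw [h𝓗, Function.update_of_ne hv]
    have hFH : 𝓕 ≤ 𝓗 := fun v => by
      by_cases hv : v = v₀
      · rw [hv, h𝓗v₀]
      · rw [h𝓗ne v hv]; exact hle v
    have hHG : 𝓗 ≤ 𝓖 := fun v => by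
      by_cases hv : v = v₀
      · rw [hv, h𝓗v₀]; exact hle v₀
      · rw [h𝓗ne v hv]
    have h𝓗S : 𝓗.IsUnramifiedOutside S := by
      refine ⟨h𝓖.1, fun v hv => ?_⟩
      have hne : (Sum.inr v : Place K) ≠ v₀ := fun h => hv (h ▸ hw₀S)
      rw [h𝓗ne _ hne]
      exact h𝓖.2 v hv
    -- one place: `𝓗 ≤ 𝓖` differ only at `v₀`
    have hone := relIndex_selmerGroup_mul_relIndex_dual_eq hperf hvan hcomp hM hS hHG h𝓗S h𝓖 hw₀S
      (fun v hv => h𝓗ne v hv)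
    rw [h𝓗v₀] at hone
    -- induction hypothesis: `𝓕 ≤ 𝓗` differ only on `T'`
    have hdiff' : ∀ v : Place K, (∀ w ∈ T', v ≠ Sum.inr w) → 𝓕 v = 𝓗 v := by
      intro v hv
      by_cases hvv : v = v₀
      · rw [hvv, h𝓗v₀]
      · rw [h𝓗ne v hvv]
        refine hdiff v fun w hw => ?_
        rcases Finset.mem_insert.mp hw with rfl | hw'
        · exact hvv
        · exact hv w hw'
    have hih := ih hT' hFH h𝓗S hdiff'
    have hprod : ∏ w ∈ T', (𝓕 (Sum.inr w)).relIndex (𝓗 (Sum.inr w)) =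
        ∏ w ∈ T', (𝓕 (Sum.inr w)).relIndex (𝓖 (Sum.inr w)) := by
      refine Finset.prod_congr rfl fun w hw => ?_
      have hne : (Sum.inr w : Place K) ≠ v₀ := fun h => hw₀ (by
        rw [hv₀] at h
        exact (Sum.inr_injective h) ▸ hw)
      rw [h𝓗ne _ hne]
    rw [hprod] at hih
    -- multiply along the chains `𝓕 ≤ 𝓗 ≤ 𝓖` and `𝓖^* ≤ 𝓗^* ≤ 𝓕^*`
    have hchain : 𝓕.selmerGroup.relIndex 𝓖.selmerGroup =
        𝓕.selmerGroup.relIndex 𝓗.selmerGroup * 𝓗.selmerGroup.relIndex 𝓖.selmerGroup :=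
      (AddSubgroup.relIndex_mul_relIndex _ _ _ (selmerGroup_mono hFH) (selmerGroup_mono hHG)).symm
    have hchain' : (inv.dualSelmerStructure ρ 𝓖).selmerGroup.relIndex
          (inv.dualSelmerStructure ρ 𝓕).selmerGroup =
        (inv.dualSelmerStructure ρ 𝓖).selmerGroup.relIndex
            (inv.dualSelmerStructure ρ 𝓗).selmerGroup *
          (inv.dualSelmerStructure ρ 𝓗).selmerGroup.relIndex
            (inv.dualSelmerStructure ρ 𝓕).selmerGroup :=
      (AddSubgroup.relIndex_mul_relIndex _ _ _
        (selmerGroup_mono (inv.dualSelmerStructure_anti ρ hHG))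
        (selmerGroup_mono (inv.dualSelmerStructure_anti ρ hFH))).symm
    rw [Finset.prod_insert hw₀, hchain, hchain', ← hone, ← hih]
    ring

/-- **`[H¹_𝓖 : H¹_𝓕] ∣ ∏_{v ∈ T} [𝓖_v : 𝓕_v]`**, the cofactor being the index of the dual Selmer
groups. [cite: Howard2004HeegnerKolyvagin, Thm. 2.1.11 (arXiv:1202.6340 p. 6)] -/
theorem relIndex_selmerGroup_dvd_prod [NeZero n] (hperf : inv.IsPerfect)
    (hvan : inv.SumLocalTermEqZero) (hcomp : inv.SelmerComplement) (hM : ∀ m : M, n • m = 0)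
    (hS : ∀ v : HeightOneSpectrum (𝓞 K), (Sum.inr v : Place K) ∉ S →
      ((n : ℕ) : 𝓞 K) ∉ v.asIdeal ∧ GaloisRep.IsUnramifiedAt v ρ)
    (T : Finset (HeightOneSpectrum (𝓞 K))) (hT : ∀ w ∈ T, (Sum.inr w : Place K) ∈ S)
    {𝓕 𝓖 : SelmerStructure ρ} (hle : 𝓕 ≤ 𝓖)
    (h𝓖 : 𝓖.IsUnramifiedOutside S) (hdiff : ∀ v : Place K, (∀ w ∈ T, v ≠ Sum.inr w) → 𝓕 v = 𝓖 v) :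
    𝓕.selmerGroup.relIndex 𝓖.selmerGroup ∣ ∏ w ∈ T, (𝓕 (Sum.inr w)).relIndex (𝓖 (Sum.inr w)) :=
  Dvd.intro _ (relIndex_selmerGroup_mul_relIndex_dual_eq_prod hperf hvan hcomp hM hS T hT hle h𝓖 hdiff)

/-- **`[H¹_𝓖 : H¹_𝓕] = ∏_{v ∈ T} [𝓖_v : 𝓕_v]` iff `H¹_{𝓕^*}(K, M^D) = H¹_{𝓖^*}(K, M^D)`** — the
localisation `H¹_𝓖/H¹_𝓕 ↪ ⊕_{v ∈ T} 𝓖_v/𝓕_v` is onto iff the dual Selmer groups agree (provided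
the local indices are non-zero, i.e. finite — automatic for finite `M`).
[cite: Howard2004HeegnerKolyvagin, Thm. 2.1.11 (arXiv:1202.6340 p. 6)]
[cite: JetchevSkinnerWan2017, Prop. 3.2.1 and Prop. 3.3.2 (arXiv:1512.06894 pp. 10–11)] -/
theorem relIndex_selmerGroup_eq_prod_iff_dual [NeZero n] (hperf : inv.IsPerfect)
    (hvan : inv.SumLocalTermEqZero) (hcomp : inv.SelmerComplement) (hM : ∀ m : M, n • m = 0)
    (hS : ∀ v : HeightOneSpectrum (𝓞 K), (Sum.inr v : Place K) ∉ S →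
      ((n : ℕ) : 𝓞 K) ∉ v.asIdeal ∧ GaloisRep.IsUnramifiedAt v ρ)
    (T : Finset (HeightOneSpectrum (𝓞 K))) (hT : ∀ w ∈ T, (Sum.inr w : Place K) ∈ S)
    {𝓕 𝓖 : SelmerStructure ρ} (hle : 𝓕 ≤ 𝓖)
    (h𝓖 : 𝓖.IsUnramifiedOutside S) (hdiff : ∀ v : Place K, (∀ w ∈ T, v ≠ Sum.inr w) → 𝓕 v = 𝓖 v)
    (hpos : ∏ w ∈ T, (𝓕 (Sum.inr w)).relIndex (𝓖 (Sum.inr w)) ≠ 0) :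
    𝓕.selmerGroup.relIndex 𝓖.selmerGroup = ∏ w ∈ T, (𝓕 (Sum.inr w)).relIndex (𝓖 (Sum.inr w)) ↔
      (inv.dualSelmerStructure ρ 𝓕).selmerGroup = (inv.dualSelmerStructure ρ 𝓖).selmerGroup := by
  have h := relIndex_selmerGroup_mul_relIndex_dual_eq_prod hperf hvan hcomp hM hS T hT hle h𝓖 hdiff
  have hanti : (inv.dualSelmerStructure ρ 𝓖).selmerGroup ≤ (inv.dualSelmerStructure ρ 𝓕).selmerGroup :=
    selmerGroup_mono (inv.dualSelmerStructure_anti ρ hle)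
  constructor
  · intro heq
    rw [heq] at h
    have h1 : (inv.dualSelmerStructure ρ 𝓖).selmerGroup.relIndex
        (inv.dualSelmerStructure ρ 𝓕).selmerGroup = 1 := by
      have := h
      nth_rw 2 [← mul_one (∏ w ∈ T, (𝓕 (Sum.inr w)).relIndex (𝓖 (Sum.inr w)))] at this
      exact Nat.eq_of_mul_eq_mul_left (Nat.pos_of_ne_zero hpos) this
    exact le_antisymm (AddSubgroup.relIndex_eq_one.mp h1) hanti
  · intro heq
    rw [heq, AddSubgroup.relIndex_self, mul_one] at h
    exact h

end Summit.BirchSwinnertonDyer.Rank1Residual.Additive.PoitouTateCountingProduct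

end
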